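import Mathlib
import Literature.Barriers.ValiantsHypothesis.MonotoneGapDecomposition
import Literature.Barriers.ValiantsHypothesis.MonotoneGapParseTrees
import Literature.Computability.AlgebraicComplexity.ArithCircuitProofs
import Summits.ValiantsHypothesis.ValiantsHypothesis.Theorems.DivisionGapPerMultiplesHardStubTypedDecomposition

/-!
# The VERTEX-typed, vertex-support-balanced decomposition of a monotone circuit

Route `ValiantsHypothesis/FifoMatching`, helper toward crux stmt-ValiantsHypothesis-21181; engine of the sibling file
`FifoMatchingNNPowersNotCertificates.lean`.  The tree's typed decomposition
(`DivisionGap.PerMultiplesHard.TypedDecomposition.stub_typedDecomposition`) grades matrix variables by ROW and COLUMN sums;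
`NN_n` (arcs `(i,j)`, `i<j`) is not bi-homogeneous there (a point opens one matching and closes another) but IS homogeneous
for the VERTEX torus `x_(i,j) ↦ t_i t_j x_(i,j)`.  This file re-runs Jerrum–Snir's balanced decomposition with the VERTEX
WEIGHTS `W_i(m) = Σ_j (m(i,j) + m(j,i))` and the VERTEX SUPPORT `V(p) = (vars p).image fst ∪ (vars p).image snd` as the
sub-additive measure (the template's abstract descent `exists_window_operand` is imported; a
variable touches `≤ 2` points, so `N ≥ 6`).  ★ `vertexTypedDecomposition`: for `N ≥ 6`, a vertex-homogeneous `g` over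
`ℝ≥0` (weights `R`, all `≠ 0`) is `Σ_{t<s} a_t b_t`, `s ≤ L₊(g)`, each `a_t` vertex-homogeneous with weights `ρ`,
`N < 3·#{ρ ≠ 0} ≤ 2N`.  Monotone-world engine only; VP ≠ VNP is NOT proved.
References: Jerrum–Snir, J. ACM 29 (1982) §3.1 Lemma 3.1, §3.3 [JerrumSnir1982].
-/

noncomputable section

open MvPolynomial Literature.Computability.AlgebraicComplexity
open scoped NNReal BigOperators
open Literature.Barriers.ValiantsHypothesis
open Literature.Computability.AlgebraicComplexity.ArithCircuit
open Summit.ValiantsHypothesis.ValiantsHypothesis.Theorems.DivisionGap.PerMultiplesHard.TypedDecomposition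
  (exists_window_operand getD_gateValues_set_zeroGate eq_zero_of_zero_eq_add)

-- the mandated summit-side namespace repeats a component by design (single-problem summit)
set_option linter.dupNamespace false

namespace Summit.ValiantsHypothesis.ValiantsHypothesis.Theorems.FifoMatching
namespace VertexTyped

/-! ### The vertex support `V(p) = rows ∪ columns hit by p` and its sub-additivity -/
section VSupp
variable {k : Type*} [CommSemiring k] {α : Type*} [DecidableEq α]

/-- Monotonicity of the vertex-support count under `vars`-inclusion into a union. [folklore] -/
theorem card_vsupp_le_of_vars_subset {p q r : MvPolynomial (α × α) k} (h : r.vars ⊆ p.vars ∪ q.vars) :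
    (r.vars.image Prod.fst ∪ r.vars.image Prod.snd).card ≤
      (p.vars.image Prod.fst ∪ p.vars.image Prod.snd).card +
        (q.vars.image Prod.fst ∪ q.vars.image Prod.snd).card := by
  refine le_trans (Finset.card_le_card ?_) (Finset.card_union_le _ _)
  intro i hi
  simp only [Finset.mem_union, Finset.mem_image] at hi ⊢
  rcases hi with ⟨e, he, rfl⟩ | ⟨e, he, rfl⟩
  · rcases Finset.mem_union.mp (h he) with h' | h'
    · exact Or.inl (Or.inl ⟨e, h', rfl⟩)
    · exact Or.inr (Or.inl ⟨e, h', rfl⟩)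
  · rcases Finset.mem_union.mp (h he) with h' | h'
    · exact Or.inl (Or.inr ⟨e, h', rfl⟩)
    · exact Or.inr (Or.inr ⟨e, h', rfl⟩)

/-- Vertex support of a sum, counted. [folklore] -/
theorem card_vsupp_add_le (p q : MvPolynomial (α × α) k) :
    ((p + q).vars.image Prod.fst ∪ (p + q).vars.image Prod.snd).card ≤
      (p.vars.image Prod.fst ∪ p.vars.image Prod.snd).card +
        (q.vars.image Prod.fst ∪ q.vars.image Prod.snd).card :=
  card_vsupp_le_of_vars_subset (vars_add_subset p q)

/-- Vertex support of a product, counted. [folklore] -/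
theorem card_vsupp_mul_le (p q : MvPolynomial (α × α) k) :
    ((p * q).vars.image Prod.fst ∪ (p * q).vars.image Prod.snd).card ≤
      (p.vars.image Prod.fst ∪ p.vars.image Prod.snd).card +
        (q.vars.image Prod.fst ∪ q.vars.image Prod.snd).card :=
  card_vsupp_le_of_vars_subset (vars_mul p q)

/-- Vertex support of a scalar multiple, counted. [folklore] -/
theorem card_vsupp_smul_le (c : k) (p : MvPolynomial (α × α) k) :
    ((c • p).vars.image Prod.fst ∪ (c • p).vars.image Prod.snd).card ≤
      (p.vars.image Prod.fst ∪ p.vars.image Prod.snd).card := by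
  refine Finset.card_le_card ?_
  have h : (c • p).vars ⊆ p.vars := by
    rw [smul_eq_C_mul]
    refine (vars_mul _ _).trans ?_
    rw [vars_C, Finset.empty_union]
  exact Finset.union_subset_union (Finset.image_subset_image h) (Finset.image_subset_image h)

/-- A variable `x_(i,j)` touches at most two points. [folklore] -/
theorem card_vsupp_X_le (e : α × α) :
    ((X e : MvPolynomial (α × α) k).vars.image Prod.fst ∪
      (X e : MvPolynomial (α × α) k).vars.image Prod.snd).card ≤ 2 := by
  refine le_trans (Finset.card_union_le _ _) ?_
  have h : (X e : MvPolynomial (α × α) k).vars ⊆ {e} := by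
    intro v hv
    rw [MvPolynomial.vars_def, Multiset.mem_toFinset] at hv
    exact Finset.mem_singleton.mpr
      (Multiset.mem_singleton.mp (Multiset.mem_of_le (MvPolynomial.degrees_X' (R := k) e) hv))
  have h1 : ((X e : MvPolynomial (α × α) k).vars.image Prod.fst).card ≤ 1 :=
    le_trans (Finset.card_le_card (Finset.image_subset_image h)) (by simp)
  have h2 : ((X e : MvPolynomial (α × α) k).vars.image Prod.snd).card ≤ 1 :=
    le_trans (Finset.card_le_card (Finset.image_subset_image h)) (by simp)
  omega

/-- A constant touches no point. [folklore] -/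
theorem card_vsupp_C (c : k) :
    ((C c : MvPolynomial (α × α) k).vars.image Prod.fst ∪
      (C c : MvPolynomial (α × α) k).vars.image Prod.snd).card = 0 := by
  rw [vars_C, Finset.image_empty, Finset.image_empty, Finset.union_empty, Finset.card_empty]

end VSupp
/-! ### Vertex weights and typing over `ℝ≥0` -/
variable {N : ℕ}

/-- A nonzero vertex-typed `g` with all weights positive touches every point. [folklore] -/
theorem vsupp_eq_univ {g : MvPolynomial (Fin N × Fin N) ℝ≥0} {R : Fin N → ℕ}
    (hg : ∀ m ∈ g.support, ∀ i, ∑ j, (m (i, j) + m (j, i)) = R i) (hR : ∀ i, R i ≠ 0) (h0 : g ≠ 0) :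
    g.vars.image Prod.fst ∪ g.vars.image Prod.snd = Finset.univ := by
  obtain ⟨m, hm⟩ := support_nonempty.mpr h0
  refine Finset.eq_univ_of_forall fun i => ?_
  have hi : ∑ j, (m (i, j) + m (j, i)) ≠ 0 := by rw [hg m hm i]; exact hR i
  obtain ⟨j, -, hj⟩ := Finset.exists_ne_zero_of_sum_ne_zero hi
  rw [Finset.mem_union, Finset.mem_image, Finset.mem_image]
  by_cases h1 : m (i, j) ≠ 0
  · exact Or.inl ⟨(i, j), (mem_vars_iff_mem_support _).mpr ⟨m, hm, Finsupp.mem_support_iff.mpr h1⟩, rfl⟩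
  · have h2 : m (j, i) ≠ 0 := by omega
    exact Or.inr ⟨(j, i), (mem_vars_iff_mem_support _).mpr ⟨m, hm, Finsupp.mem_support_iff.mpr h2⟩, rfl⟩

/-- For a vertex-typed `p ≠ 0` the points of nonzero weight are exactly its vertex support. [folklore] -/
theorem filter_ne_zero_eq_vsupp {p : MvPolynomial (Fin N × Fin N) ℝ≥0} {ρ : Fin N → ℕ}
    (hp : ∀ m ∈ p.support, ∀ i, ∑ j, (m (i, j) + m (j, i)) = ρ i) (h0 : p ≠ 0) :
    (Finset.univ.filter fun i => ρ i ≠ 0) = p.vars.image Prod.fst ∪ p.vars.image Prod.snd := by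
  obtain ⟨m₀, hm₀⟩ := support_nonempty.mpr h0
  ext i
  simp only [Finset.mem_filter, Finset.mem_univ, true_and, Finset.mem_union, Finset.mem_image,
    mem_vars_iff_mem_support, Prod.exists]
  constructor
  · intro hi
    rw [← hp m₀ hm₀ i] at hi
    obtain ⟨j, -, hj⟩ := Finset.exists_ne_zero_of_sum_ne_zero hi
    by_cases h1 : m₀ (i, j) ≠ 0
    · exact Or.inl ⟨i, j, ⟨m₀, hm₀, Finsupp.mem_support_iff.mpr h1⟩, rfl⟩
    · have h2 : m₀ (j, i) ≠ 0 := by omega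
      exact Or.inr ⟨j, i, ⟨m₀, hm₀, Finsupp.mem_support_iff.mpr h2⟩, rfl⟩
  · rintro (⟨i', j, ⟨m, hm, he⟩, hii'⟩ | ⟨j, i', ⟨m, hm, he⟩, hii'⟩)
    · subst hii'
      rw [← hp m hm i']
      intro hsum
      have := Finset.sum_eq_zero_iff.mp hsum j (Finset.mem_univ _)
      exact (Finsupp.mem_support_iff.mp he) (by omega)
    · subst hii'
      rw [← hp m hm i']
      intro hsum
      have := Finset.sum_eq_zero_iff.mp hsum j (Finset.mem_univ _)
      exact (Finsupp.mem_support_iff.mp he) (by omega)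

/-- Gate typing: `supp (p * q) ⊆ supp g`, `q ≠ 0`, `g` vertex-typed ⇒ `p` vertex-typed (no cancellation over `ℝ≥0`).
[cite: JerrumSnir1982, §3.1 (Lemma 3.1(iii))] -/
theorem exists_vweights_of_support_mul_subset {g p q : MvPolynomial (Fin N × Fin N) ℝ≥0} {R : Fin N → ℕ}
    (hg : ∀ m ∈ g.support, ∀ i, ∑ j, (m (i, j) + m (j, i)) = R i)
    (hpq : (p * q).support ⊆ g.support) (hq : q ≠ 0) :
    ∃ ρ : Fin N → ℕ, ∀ m ∈ p.support, ∀ i, ∑ j, (m (i, j) + m (j, i)) = ρ i := by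
  obtain ⟨b, hb⟩ := support_nonempty.mpr hq
  refine ⟨fun i => R i - ∑ j, (b (i, j) + b (j, i)), fun m hm i => ?_⟩
  have hmb : m + b ∈ g.support :=
    hpq (by rw [JerrumSnir.support_mul_eq]; exact Finset.add_mem_add hm hb)
  have h := hg _ hmb i
  simp only [Finsupp.coe_add, Pi.add_apply, Finset.sum_add_distrib] at h ⊢
  omega

/-! ### The balanced gate, the peeling induction, the decomposition -/
/-- **A vertex-balanced gate**: a fan-in-two circuit over `ℝ≥0` computing a nonzero vertex-typed polynomial (weights
`R > 0`, `N ≥ 6` points) has a gate value with vertex support `k`, `N < 3k ≤ 2N`. [cite: JerrumSnir1982, §3.3] -/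
theorem exists_vbalanced_gate (hN : 6 ≤ N) (R : Fin N → ℕ) (hR : ∀ i, R i ≠ 0)
    (P : ArithCircuit ℝ≥0 (Fin N × Fin N)) (h2 : P.IsFanInTwo)
    (hg : ∀ m ∈ P.eval.support, ∀ i, ∑ j, (m (i, j) + m (j, i)) = R i) (h0 : P.eval ≠ 0) :
    ∃ v : ℕ, N < 3 * (((gateValues P.gates).getD v 0).vars.image Prod.fst ∪
        ((gateValues P.gates).getD v 0).vars.image Prod.snd).card ∧
      3 * (((gateValues P.gates).getD v 0).vars.image Prod.fst ∪
        ((gateValues P.gates).getD v 0).vars.image Prod.snd).card ≤ 2 * N := by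
  have huniv := vsupp_eq_univ hg hR h0
  have hout : 2 * N < 3 * (P.eval.vars.image Prod.fst ∪ P.eval.vars.image Prod.snd).card := by
    rw [huniv, Finset.card_univ, Fintype.card_fin]; omega
  exact exists_window_operand P.gates h2
    (fun p : MvPolynomial (Fin N × Fin N) ℝ≥0 => (p.vars.image Prod.fst ∪ p.vars.image Prod.snd).card) N
    card_vsupp_add_le card_vsupp_mul_le card_vsupp_smul_le
    (fun e => le_trans (Nat.mul_le_mul_left 3 (card_vsupp_X_le e)) hN) card_vsupp_C P.output hout

/-- **The peeling induction (vertex grading)**: zero a balanced gate (`exists_eval_eq_zeroAt_add`), type its value through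
`supp (p_v · q) ⊆ supp P.eval`, recurse on `P.zeroAt v`; at most `K` rounds. [cite: JerrumSnir1982, §3 (Lemma 3.1(iii), Thm. 3.2)] -/
theorem exists_vtyped_list (hN : 6 ≤ N) (R : Fin N → ℕ) (hR : ∀ i, R i ≠ 0) :
    ∀ (K : ℕ) (P : ArithCircuit ℝ≥0 (Fin N × Fin N)), P.IsFanInTwo →
      (∃ Z : Finset ℕ, Z.card ≤ K ∧ ∀ j ∉ Z, (gateValues P.gates).getD j 0 = 0) →
      (∀ m ∈ P.eval.support, ∀ i, ∑ j, (m (i, j) + m (j, i)) = R i) →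
      ∃ L : List (MvPolynomial (Fin N × Fin N) ℝ≥0 × MvPolynomial (Fin N × Fin N) ℝ≥0),
        L.length ≤ K ∧ P.eval = (L.map fun ab => ab.1 * ab.2).sum ∧
        ∀ ab ∈ L, ∃ ρ : Fin N → ℕ,
          (∀ m ∈ ab.1.support, ∀ i, ∑ j, (m (i, j) + m (j, i)) = ρ i) ∧
          N < 3 * (Finset.univ.filter fun i => ρ i ≠ 0).card ∧
          3 * (Finset.univ.filter fun i => ρ i ≠ 0).card ≤ 2 * N := by
  intro K
  induction K with
  | zero =>
    rintro P h2 ⟨Z, hZc, hZ0⟩ hg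
    by_cases h0 : P.eval = 0
    · exact ⟨[], le_rfl, by simp [h0], by simp⟩
    · exfalso
      obtain ⟨v, hlo, -⟩ := exists_vbalanced_gate hN R hR P h2 hg h0
      have hv : (gateValues P.gates).getD v 0 = 0 :=
        hZ0 v (by simp [Finset.card_eq_zero.mp (Nat.le_zero.mp hZc)])
      rw [hv, vars_0, Finset.image_empty, Finset.image_empty, Finset.union_empty, Finset.card_empty] at hlo
      omega
  | succ K ih =>
    rintro P h2 ⟨Z, hZc, hZ0⟩ hg
    by_cases h0 : P.eval = 0
    · exact ⟨[], by simp, by simp [h0], by simp⟩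
    obtain ⟨v, hlo, hhi⟩ := exists_vbalanced_gate hN R hR P h2 hg h0
    obtain ⟨q, hq⟩ := exists_eval_eq_zeroAt_add P v
    have hlink := linked_gateValues_set P.gates v
    set p := (gateValues P.gates).getD v 0
    have hp0 : p ≠ 0 := by
      intro h
      rw [h, vars_0, Finset.image_empty, Finset.image_empty, Finset.union_empty, Finset.card_empty] at hlo
      omega
    have hvZ : v ∈ Z := by_contra fun h => hp0 (hZ0 v h)
    have hZ' : ∃ Z' : Finset ℕ, Z'.card ≤ K ∧
        ∀ j ∉ Z', (gateValues (P.zeroAt v).gates).getD j 0 = 0 := by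
      refine ⟨Z.erase v, ?_, fun j hj => ?_⟩
      · rw [Finset.card_erase_of_mem hvZ]; omega
      · by_cases hjv : j = v
        · subst hjv; exact getD_gateValues_set_zeroGate P.gates j
        · have hjZ : j ∉ Z := fun h => hj (Finset.mem_erase.mpr ⟨hjv, h⟩)
          obtain ⟨h, hh⟩ := hlink.2 j
          rw [hZ0 j hjZ] at hh
          exact eq_zero_of_zero_eq_add hh
    have hg' : ∀ m ∈ (P.zeroAt v).eval.support, ∀ i, ∑ j, (m (i, j) + m (j, i)) = R i :=
      fun m hm => hg m (support_subset_of_eq_add hq hm)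
    obtain ⟨L, hLlen, hLsum, hLtyp⟩ := ih (P.zeroAt v) (h2.zeroAt v) hZ' hg'
    by_cases hq0 : q = 0
    · refine ⟨L, by omega, ?_, hLtyp⟩
      rw [hq, hq0, mul_zero, add_zero, hLsum]
    · have hsub : (p * q).support ⊆ P.eval.support :=
        support_subset_of_eq_add (hq.trans (add_comm _ _))
      obtain ⟨ρ, hty⟩ := exists_vweights_of_support_mul_subset hg hsub hq0
      refine ⟨(p, q) :: L, by simpa using hLlen, ?_, ?_⟩
      · simp only [List.map_cons, List.sum_cons]
        rw [hq, hLsum, add_comm]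
      · intro ab hab
        rcases List.mem_cons.mp hab with rfl | hab
        · refine ⟨ρ, hty, ?_⟩
          rw [filter_ne_zero_eq_vsupp hty hp0]
          exact ⟨hlo, hhi⟩
        · exact hLtyp ab hab

/-- ★ **The vertex-typed, vertex-support-balanced decomposition**: for `N ≥ 6`, a vertex-homogeneous `g` over `ℝ≥0`
(weights `R`, all `≠ 0`) is `g = Σ_{t<s} a_t · b_t`, `s ≤ L₊(g)`, each `a_t` vertex-homogeneous with weights `ρ`,
`N < 3·#{ρ ≠ 0} ≤ 2N`. [cite: JerrumSnir1982, §3 (Lemma 3.1(iii), Thm. 3.2, Thm. 3.4)] -/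
theorem vertexTypedDecomposition (hN : 6 ≤ N) (g : MvPolynomial (Fin N × Fin N) ℝ≥0) (R : Fin N → ℕ)
    (hg : ∀ m ∈ g.support, ∀ i, ∑ j, (m (i, j) + m (j, i)) = R i) (hR : ∀ i, R i ≠ 0) :
    ∃ s : ℕ, s ≤ complexity g ∧
      ∃ a b : Fin s → MvPolynomial (Fin N × Fin N) ℝ≥0,
        g = ∑ t, a t * b t ∧
        ∀ t, ∃ ρ : Fin N → ℕ,
          (∀ m ∈ (a t).support, ∀ i, ∑ j, (m (i, j) + m (j, i)) = ρ i) ∧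
          N < 3 * (Finset.univ.filter fun i => ρ i ≠ 0).card ∧
          3 * (Finset.univ.filter fun i => ρ i ≠ 0).card ≤ 2 * N := by
  obtain ⟨P, h2, hPg, hsize⟩ := exists_computes_size_eq_complexity g
  have heval : P.eval = g := hPg
  subst heval
  have hZ : ∃ Z : Finset ℕ, Z.card ≤ P.size ∧ ∀ j ∉ Z, (gateValues P.gates).getD j 0 = 0 := by
    refine ⟨Finset.range P.size, by simp, fun j hj => getD_gateValues_eq_zero ?_⟩
    exact List.getElem?_eq_none_iff.mpr (by simpa [ArithCircuit.size] using hj)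
  obtain ⟨L, hLlen, hLsum, hLtyp⟩ := exists_vtyped_list hN R hR P.size P h2 hZ hg
  refine ⟨L.length, hsize ▸ hLlen, fun t => (L[t.1]).1, fun t => (L[t.1]).2, ?_,
    fun t => hLtyp _ (List.getElem_mem _)⟩
  rw [Fin.sum_univ_fun_getElem L (fun ab => ab.1 * ab.2)]
  exact hLsum

end VertexTyped
end Summit.ValiantsHypothesis.ValiantsHypothesis.Theorems.FifoMatching
end
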